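import Literature.Computability.MetaComplexity.NoRefuterLevels
import HarnessLib

/-!
# Hard `NP` languages without refuters (Chen–Jin–Santhanam–Williams, Thm. 1.9, first part): the theorem

Topic `Literature/Computability/MetaComplexity`; last file of the series `NoRefuterFormat.lean`,
`NoRefuterSearch.lean`, `NoRefuterLevels.lean`, and proof companion of the named fact
`exists_NP_diff_P_without_PRefuter` of `ConstructiveSeparations.lean`, which transcribes the PRINTED
Theorem 1.9 (first part) of [ChenEtAl2022] ("If `NE ≠ E`, then there is a language in `NP ∖ P` that
does not have `P` refuters against the constant one function"). Its printed proof has an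
infinitely-often / almost-everywhere gap (explained at
`exists_NP_diff_P_without_PRefuter_of_not_NE_subset_ioE` below) and establishes the statement only
from the hypothesis `NE ⊄ io-E`. This file states that corrected form under its own name and PROVES
it (`…_holds`), assembling `NoRefuterFormat.lean` (the language `B`, (S1)–(S4)),
`NoRefuterSearch.lean` (the decoder: a refuter gives `L' ∈ io-E`; the prefix search) and
`NoRefuterLevels.lean` (Claim 1: `B ∈ P` gives `L' ∈ E`). The printed form keeps its name and
statement in `ConstructiveSeparations.lean`, where it is deprecated as mis-stated (verdict of its prove
seat, 2026-08-15: not established by its source); `…_of_printed` records that it implies the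
corrected form.
(The module docstrings of `NoRefuterFormat.lean` / `NoRefuterSearch.lean` announce this assembly
under the file name `ConstructiveSeparationsProofs.lean`; that file meanwhile hosts the proof of
Thm. 1.2 for `(P, NP)`, so the assembly lives here.)

## References

* L. Chen, C. Jin, R. Santhanam, R. Williams, *Constructive separations and their consequences*,
  FOCS 2021 (IEEE 2022), pp. 646–657 = arXiv:2203.14379 (v5 = TheoretiCS 3 (2024)): Thm. 1.9 and §6,
  Proof of Thm. 1.9 (text checked: arXiv v5 HTML, §6; the held arXiv source, chunk 22). [ChenEtAl2022]
-/

noncomputable section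

namespace Literature.Computability.MetaComplexity

open _root_.Computability Polynomial Complexity Brick Filter Nondeterministic

/-! ### Theorem 1.9, first part, in the form its printed proof establishes -/

/-- **Thm. 1.9 (first part) with the almost-everywhere hypothesis its proof uses.** The printed
statement is `exists_NP_diff_P_without_PRefuter` (`ConstructiveSeparations.lean`: "If `NE ≠ E`, then
there is a language in `NP ∖ P` that does not have `P` refuters against the constant one function").
Its printed proof (§6, Proof of Thm. 1.9, read in arXiv:2203.14379v5 — the TheoretiCS 2024 version, whose
numbering `ConstructiveSeparations.lean` follows — and in the held arXiv source) takes `L' ∈ NE ∖ E`, forms the `coNP` language `L` of strings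
`(t, w_0, …, w_{2ᵐ-1}, s)` in which `t` is the truth table of `L'` on `{0,1}ᵐ` certified by
`NE`-witnesses `wᵢ` for its ones (and by the `coNP` condition "`tᵢ = 0 ⇒ i ∉ L'`" for its zeros) and
`s ∉ SAT`, shows `L̄ ∈ NP ∖ P` (Claim 1), and ends: "If there is such a refuter, then it must output
in `2^{O(m)}` time a string `(t, w_0, …, s) ∈ L`. … Hence, we can use this refuter to decide `L'` on
`m`-bit inputs in `2^{O(m)}` time, contradicting `L' ∉ E`." But a refuter (Def. 1.1, `IsPRefuter`) is
only required to succeed for INFINITELY MANY `n`; at the other lengths its output need not lie in `L`,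
and membership in the `coNP` language `L` cannot be tested within deterministic time `2^{O(m)}`, so
the algorithm so obtained decides `L'` correctly on infinitely many input lengths only — it places
`L'` in `io-E` (the tree's `io E`, `Classes.lean`), which does not contradict `L' ∉ E`. What the
argument proves is the statement below, whose hypothesis `NE ⊄ io-E` — some `NE` language on which
every `2^{O(n)}`-time algorithm errs at all but finitely many input lengths — is the
almost-everywhere form of `NE ≠ E` that this last step consumes (it implies `NE ≠ E`, cf.
`exists_NP_diff_P_without_PRefuter_of_not_NE_subset_ioE_of_printed`). (Keeping `NE ≠ E` one obtains
instead only that no `P`-refuter succeeds at ALL sufficiently large `n`.) The printed form keeps its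
name and statement (deprecated as mis-stated, 2026-08-15); this corrected form is PROVED below
(`exists_NP_diff_P_without_PRefuter_of_not_NE_subset_ioE_holds`, files `NoRefuterFormat.lean`,
`NoRefuterSearch.lean`, `NoRefuterLevels.lean`), following the printed construction with `SAT`
replaced by the self-reduction queries of the tally language of `L'` (which is all that Claim 1 uses
`SAT` for). [cite: ChenEtAl2022, Thm. 1.9 (first part) and §6, Proof of Thm. 1.9] -/
def exists_NP_diff_P_without_PRefuter_of_not_NE_subset_ioE : Prop :=
  ¬ NE ⊆ io E → ∃ L ∈ Nondeterministic.NP, L ∉ Classes.P ∧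
    ∀ R : ℕ → List Bool, ¬ IsPRefuter L (Set.univ : Set (List Bool)) R

/-- `E ⊆ io E`: a language agrees with itself at every length. [folklore] -/
theorem E_subset_io_E : E ⊆ io E := fun L hL =>
  ⟨L, hL, Filter.Frequently.of_forall fun _ _ _ => Iff.rfl⟩

-- `linter.deprecated` is switched off for the next declaration only: its hypothesis is the printed
-- rendering `exists_NP_diff_P_without_PRefuter` (`ConstructiveSeparations.lean`), deprecated as
-- mis-stated (verdict of its prove seat, 2026-08-15: the printed proof establishes only the form with
-- hypothesis `NE ⊄ io-E`); this bridge records what the printed `Prop` implies and must keep naming it.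
set_option linter.deprecated false in
/-- The corrected form of Thm. 1.9 (hypothesis `NE ⊄ io-E`) is implied by the printed form
(hypothesis `NE ≠ E`), since `NE ⊄ io-E` implies `NE ≠ E` (`E ⊆ io-E`). [cite: ChenEtAl2022, Thm. 1.9] -/
theorem exists_NP_diff_P_without_PRefuter_of_not_NE_subset_ioE_of_printed
    (h : exists_NP_diff_P_without_PRefuter) :
    exists_NP_diff_P_without_PRefuter_of_not_NE_subset_ioE := fun hio =>
  h fun heq => hio (heq ▸ E_subset_io_E)

/-- **The oracle hypothesis of the search holds for `B`** (property (S2)). [folklore] -/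
theorem NoRefuter.oracleOK_B {T V : Language Bool} {p : Polynomial ℕ} {D : ℕ} (hD : 0 < D)
    (hver : IsPolyVerifierFor V p T) : NoRefuter.OracleOK V p D (NoRefuter.B T V p D) :=
  fun _ _ s pad hes hz => NoRefuter.mem_B_iff_of_tableOK hD hver hes s pad hz

/-- **Proof of the corrected Thm. 1.9 (first part).** Let `L' ∈ NE ∖ io-E`, `L' ∈ NTIME(2^{an})`; its
tally language `T = {1^{tnum x} | x ∈ L'}` is in `NP` (`AvgTallyNE.tallyLang_mem_NP`), with a
`P`-verifier `V` and witness bound `p`; fix the format constant `D` of `NoRefuter.exists_canon_fits` and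
take `L := NoRefuter.B T V p D ∈ NP` (S1). If `L ∈ P`, the level-by-level search
(`NoRefuter.mem_E_of_oracle`, Claim 1) puts `L'` in `E ⊆ io-E`; and a `P`-refuter for `L` against the
constant-one algorithm puts `L'` in `io-E` (`NoRefuter.mem_io_E_of_isPRefuter`); both contradict
`L' ∉ io-E`. [cite: ChenEtAl2022, Thm. 1.9 (first part) and §6, Proof of Thm. 1.9] -/
theorem exists_NP_diff_P_without_PRefuter_of_not_NE_subset_ioE_holds :
    exists_NP_diff_P_without_PRefuter_of_not_NE_subset_ioE := by
  intro hNE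
  obtain ⟨L', hL'NE, hL'io⟩ := Set.not_subset.1 hNE
  simp only [NE, Set.mem_iUnion] at hL'NE
  obtain ⟨a, ha⟩ := hL'NE
  have hT : AvgTallyNE.tallyLang L' ∈ NP := AvgTallyNE.tallyLang_mem_NP ha
  obtain ⟨V, hV, p, hver⟩ := mem_NP_iff_verifier.1 hT
  have hL' : ∀ x, x ∈ L' ↔ ones (bitsToNat x + 2 ^ x.length) ∈ AvgTallyNE.tallyLang L' := fun x => by
    rw [AvgTallyNE.mem_iff_unaryEncodeNat_tnum_mem_tallyLang L' x, AvgTallyNE.tnum_eq, unaryEncodeNat_eq_replicate]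
  obtain ⟨D, hD, hfitD⟩ := NoRefuter.exists_canon_fits p
  refine ⟨NoRefuter.B (AvgTallyNE.tallyLang L') V p D, NoRefuter.B_mem_NP p D hT hV, fun hBP => hL'io ?_,
    fun R hR => hL'io ?_⟩
  · exact E_subset_io_E (NoRefuter.mem_E_of_oracle hD hver (NoRefuter.oracleOK_B hD hver) hBP
      (NoRefuter.fitsLv_of_canon_fits hfitD) hL')
  · exact NoRefuter.mem_io_E_of_isPRefuter hD hver hL' hR

end Literature.Computability.MetaComplexity
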